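import Mathlib
import Summits.Ventures.HodgeRepro2.T6A1Monomials
import Summits.Ventures.HodgeRepro2.A1EigenlineDecompositionGalois
import Summits.Ventures.HodgeRepro2.A1DescendedBijection
import Summits.Ventures.HodgeRepro2.A1Lagrange
import Summits.Ventures.HodgeRepro2.A1BaseChange
import Summits.Ventures.HodgeRepro2.BridgePairwise
import Summits.Ventures.HodgeRepro2.A2Primitive

/-!
# T6A1WeilProjector — the Weil projector is a rational polynomial in one correspondence (Prop. A2.3)

Tier-6 sub-goal A1 (route/T6-A1-t6-p1.md §1 (A1.iii), §3 layer L2). Carrier-free assembly of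
route/T4-A1-p7.md v6 Lemmas A2.1–A2.2 and Prop. A2.3 (i), (ii), (iv): `F/ℚ` finite Galois (the CM
field), `V` a finite-dimensional `F`-space (`H¹(B, ℚ)`, free of rank 4 over `F`), `E := ⋀[ℚ]^n V`
(`H^n(B, ℚ)`, Lange Ex. 1.1.6(7)), `T x := ⋀^n (x •)` (the pull-back `[x]^*`, (A0.3)(iv)). Over `F`,
`F ⊗ V` splits into the eigenlines `V_σ` (p7's `A1EigenlineDecompositionGalois`, (A0.4)) and `⋀^n` of
it into the multigraded pieces `H^{(k)}` (`T6A1Monomials`, (A0.6)), on which `T x` acts by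
`χ_k(x) = ∏_σ σ(x)^{k_σ}`; a separating `x` (Lemma A2.1, p4's pairwise form) makes these eigenvalues
distinct, the Lagrange sum over the Weil indices `k = n·e_σ` is Galois-invariant hence rational
(Lemma A2.2, p7's `A1Lagrange`), and `p_W := Q([x]^*)` is a `ℚ`-linear idempotent whose range
base-changes to the Weil summand `⊕_σ ⋀^n V_σ` (p7's `eigenSummandK`), has `ℚ`-dimension `[F : ℚ]`
(Prop. A2.3(iv)), and maps every `[x]^*`-stable subspace `A` (the algebraic classes, Prop. A2.3(ii))
into `A ⊓ W_F(B)`.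
-/

namespace Summit.Ventures.HodgeRepro2.T6.A1WeilProjector

open Polynomial
open scoped TensorProduct

variable (F : Type*) [Field F] [Algebra ℚ F] [FiniteDimensional ℚ F]
variable (V : Type*) [AddCommGroup V] [Module ℚ V] [Module F V] [IsScalarTower ℚ F V]

/-- The correspondence `[x]^* = ⋀^n (x •)` on `E = ⋀[ℚ]^n V` (a `ℚ`-linear endomorphism). -/
noncomputable def T (n : ℕ) (x : F) : Module.End ℚ (⋀[ℚ]^n V) :=
  exteriorPower.map n ((LinearMap.lsmul F V x).restrictScalars ℚ)

/-- The same operator after base change to `F`, on `⋀[F]^n (F ⊗[ℚ] V)`. -/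
noncomputable def TF (n : ℕ) (x : F) : Module.End F (⋀[F]^n (F ⊗[ℚ] V)) :=
  exteriorPower.map n (A1EigenlinePermutation.actF F x)

omit [FiniteDimensional ℚ F] in
/-- `[x]^*` on a wedge monomial: `x • ` each factor. -/
theorem T_apply_ιMulti (n : ℕ) (x : F) (w : Fin n → V) :
    T F V n x (exteriorPower.ιMulti ℚ n w) = exteriorPower.ιMulti ℚ n fun i => x • w i := by
  unfold T
  rw [exteriorPower.map_apply_ιMulti]
  rfl

omit [FiniteDimensional ℚ F] in
/-- The operators `[x]^*` commute (`(A0.2)`: `[x]^* [x']^* = [x x']^*`). -/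
theorem T_comm (n : ℕ) (x y : F) : T F V n x ∘ₗ T F V n y = T F V n y ∘ₗ T F V n x := by
  unfold T
  rw [← exteriorPower.map_comp, ← exteriorPower.map_comp]
  congr 1
  ext v
  simp only [LinearMap.comp_apply, LinearMap.coe_restrictScalars, LinearMap.lsmul_apply, smul_smul,
    mul_comm]

omit [FiniteDimensional ℚ F] in
/-- Base change of `[x]^*` is the operator `⋀^n (x ⊗ 1)` on `⋀[F]^n (F ⊗ V)`, through p7's
`baseChangeMap`. -/
theorem baseChangeMap_comp_baseChange_T (n : ℕ) (x : F) :
    A1ExteriorBaseChange.baseChangeMap ℚ F V n ∘ₗ LinearMap.baseChange F (T F V n x) =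
      TF F V n x ∘ₗ A1ExteriorBaseChange.baseChangeMap ℚ F V n := by
  apply LinearMap.restrictScalars_injective ℚ
  apply TensorProduct.ext'
  intro s e
  simp only [LinearMap.coe_restrictScalars, LinearMap.comp_apply, LinearMap.baseChange_tmul]
  rw [A1ExteriorBaseChange.baseChangeMap_tmul, A1ExteriorBaseChange.baseChangeMap_tmul, map_smul]
  congr 1
  -- reduce to wedge monomials
  have key : A1ExteriorBaseChange.toBaseChange ℚ F V n ∘ₗ T F V n x =
      (TF F V n x).restrictScalars ℚ ∘ₗ A1ExteriorBaseChange.toBaseChange ℚ F V n := by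
    apply exteriorPower.linearMap_ext
    ext w
    simp only [LinearMap.compAlternatingMap_apply, LinearMap.comp_apply, T_apply_ιMulti,
      A1ExteriorBaseChange.toBaseChange_ιMulti, LinearMap.coe_restrictScalars, TF,
      exteriorPower.map_apply_ιMulti]
    congr 1
  exact LinearMap.congr_fun key e

/-! ## The separating element (Lemma A2.1, pairwise form) -/

/-- The eigenvalue `χ_k(x) = ∏ σ, σ(x)^{k_σ}` of `[x]^*` on the piece `H^{(k)}`. -/
noncomputable def chi (n : ℕ) (x : F) (k : (F →ₐ[ℚ] F) → Fin (n + 1)) : F :=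
  ∏ σ, σ x ^ (k σ : ℕ)

/-- Lemma A2.1 in its pairwise form (p4's `BridgePairwise.exists_pairwise_separation` through an
embedding `τ₁ : F → ℂ` and a primitive element `a`): some `x = a + t` has pairwise distinct eigenvalues
`χ_k(x)` over all multi-indices `k` with entries `≤ n`. -/
theorem exists_separating_chi (n : ℕ) : ∃ x : F, Function.Injective (chi F n x) := by
  classical
  haveI : Algebra.IsAlgebraic ℚ F := Algebra.IsAlgebraic.of_finite ℚ F
  let τ₁ : F →ₐ[ℚ] ℂ := IsAlgClosed.lift
  obtain ⟨a, ha⟩ := Field.exists_primitive_element ℚ F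
  have ha' : Algebra.adjoin ℚ {a} = ⊤ := by
    rw [← IntermediateField.adjoin_simple_toSubalgebra_of_isAlgebraic
      (Algebra.IsAlgebraic.isAlgebraic a), ha]
    exact IntermediateField.top_toSubalgebra
  let r : (F →ₐ[ℚ] F) → ℂ := fun σ => τ₁ (σ a)
  have hr : Function.Injective r := fun σ σ' h =>
    A2Primitive.algHom_ext_of_adjoin_eq_top ha' (τ₁.injective h)
  obtain ⟨t, ht⟩ := BridgePairwise.exists_pairwise_separation r hr
    (Finset.univ.image fun k : (F →ₐ[ℚ] F) → Fin (n + 1) => fun σ => (k σ : ℕ))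
  refine ⟨a + (t : F), fun k k' hkk' => ?_⟩
  by_contra hne
  have hm : (fun σ => (k σ : ℕ)) ≠ fun σ => (k' σ : ℕ) := by
    intro h
    exact hne (funext fun σ => Fin.ext (congrFun h σ))
  have hprod : ∏ σ, ((t : ℂ) + r σ) ^ (k σ : ℕ) = ∏ σ, ((t : ℂ) + r σ) ^ (k' σ : ℕ) := by
    have := congrArg τ₁ hkk'
    simp only [chi, map_prod, map_pow, map_add, map_natCast] at this
    simpa only [r, add_comm] using this
  exact ht _ (Finset.mem_image_of_mem _ (Finset.mem_univ k)) _
    (Finset.mem_image_of_mem _ (Finset.mem_univ k')) hm hprod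

/-! ## The eigen-data over `F` and the Lagrange projector (Lemma A2.2, Prop. A2.3(i)) -/

variable [DecidableEq (F →ₐ[ℚ] F)]

/-- The `F`-eigenlines `V_σ ⊆ F ⊗[ℚ] V` (p7's `A1EigenlinePermutation.eigenline`). -/
noncomputable abbrev U (σ : F →ₐ[ℚ] F) : Submodule F (F ⊗[ℚ] V) :=
  A1EigenlinePermutation.eigenline F V σ

/-- (A0.4): the `F`-eigenlines span `F ⊗ V` (p7's `isInternal_eigenline_self`). -/
theorem iSup_U_eq_top [IsGalois ℚ F] : ⨆ σ, U F V σ = ⊤ :=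
  (A1EigenlineDecompositionGalois.isInternal_eigenline_self ℚ F V).submodule_iSup_eq_top

omit [FiniteDimensional ℚ F] [DecidableEq (F →ₐ[ℚ] F)] in
/-- `x ⊗ 1` acts on the eigenline `V_σ` by `σ(x)`. -/
theorem actF_apply_of_mem_U (x : F) (σ : F →ₐ[ℚ] F) {v : F ⊗[ℚ] V} (hv : v ∈ U F V σ) :
    A1EigenlinePermutation.actF F x v = σ x • v :=
  (A1EigenlinePermutation.mem_eigenline_iff σ v).1 hv x

/-- The multigrading of `⋀[F]^n (F ⊗ V)` by the `F`-eigenlines, as p4's `EigenData` for `TF x`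
(`T6A1Monomials.eigenData`), once `x` is separating. -/
theorem eigenDataF [IsGalois ℚ F] (n : ℕ) (x : F) (hx : Function.Injective (chi F n x)) :
    BridgeProjector.EigenData (TF F V n x)
      (fun k : (F →ₐ[ℚ] F) → Fin (n + 1) => A1Monomials.piece (U F V) n fun σ => (k σ : ℕ))
      (chi F n x) :=
  A1Monomials.eigenData (U F V) (iSup_U_eq_top F V) (A1EigenlinePermutation.actF F x)
    (fun σ => σ x) (fun σ _ hv => actF_apply_of_mem_U F V x σ hv) n hx

/-- The Weil multi-index `n·e_σ`. -/
def weilIdx (n : ℕ) (σ : F →ₐ[ℚ] F) : (F →ₐ[ℚ] F) → Fin (n + 1) := Pi.single σ (Fin.last n)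

variable [DecidableEq F]

/-- The node set `Λ = {χ_k(x)}` of Lemma A2.2. -/
noncomputable def nodes (n : ℕ) (x : F) : Finset F := Finset.univ.image (chi F n x)

/-- The Weil nodes `Λ_W = {σ(x)^n} = {χ_{n e_σ}(x)}` of Lemma A2.2. -/
noncomputable def weilNodes (n : ℕ) (x : F) : Finset F :=
  Finset.univ.image fun σ => chi F n x (weilIdx F n σ)

/-- The Lagrange projector polynomial `P = ∑_{λ ∈ Λ_W} ∏_{μ ∈ Λ∖{λ}} (X − μ)/(λ − μ)` of Lemma A2.2. -/
noncomputable def lagrangeP (n : ℕ) (x : F) : F[X] :=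
  ∑ a ∈ weilNodes F n x, Lagrange.basis (nodes F n x) id a

/-- Membership in the node set. -/
theorem mem_nodes {n : ℕ} {x : F} {a : F} : a ∈ nodes F n x ↔ ∃ k, chi F n x k = a := by
  simp only [nodes, Finset.mem_image, Finset.mem_univ, true_and]

/-- Membership in the Weil node set. -/
theorem mem_weilNodes {n : ℕ} {x : F} {a : F} :
    a ∈ weilNodes F n x ↔ ∃ σ, chi F n x (weilIdx F n σ) = a := by
  simp only [weilNodes, Finset.mem_image, Finset.mem_univ, true_and]

/-- `Λ_W ⊆ Λ`. -/
theorem weilNodes_subset_nodes (n : ℕ) (x : F) : weilNodes F n x ⊆ nodes F n x := by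
  intro a ha
  obtain ⟨σ, rfl⟩ := (mem_weilNodes F).1 ha
  exact (mem_nodes F).2 ⟨_, rfl⟩

/-- Lemma A2.2(i): `P = 1` at the Weil nodes and `P = 0` at the other nodes. -/
theorem eval_lagrangeP (n : ℕ) (x : F) (hx : Function.Injective (chi F n x))
    (k : (F →ₐ[ℚ] F) → Fin (n + 1)) :
    (lagrangeP F n x).eval (chi F n x k) = if ∃ σ, k = weilIdx F n σ then 1 else 0 := by
  unfold lagrangeP
  split_ifs with h
  · obtain ⟨σ, rfl⟩ := h
    exact A1Lagrange.eval_lagrangeSum_of_mem _ _ (weilNodes_subset_nodes F n x)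
      ((mem_weilNodes F).2 ⟨σ, rfl⟩)
  · apply A1Lagrange.eval_lagrangeSum_of_notMem
    · exact (mem_nodes F).2 ⟨_, rfl⟩
    · intro hmem
      obtain ⟨σ, hσ⟩ := (mem_weilNodes F).1 hmem
      exact h ⟨σ, hx hσ.symm⟩

omit [FiniteDimensional ℚ F] [DecidableEq F] [DecidableEq (F →ₐ[ℚ] F)] in
/-- The Galois action permutes the embeddings: `σ ↦ g ∘ σ`. -/
def galPerm (g : Gal(F/ℚ)) : (F →ₐ[ℚ] F) ≃ (F →ₐ[ℚ] F) where
  toFun σ := g.toAlgHom.comp σ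
  invFun σ := g.symm.toAlgHom.comp σ
  left_inv σ := by ext v; simp
  right_inv σ := by ext v; simp

omit [FiniteDimensional ℚ F] [DecidableEq F] [DecidableEq (F →ₐ[ℚ] F)] in
/-- `galPerm g σ = g ∘ σ`. -/
theorem galPerm_apply (g : Gal(F/ℚ)) (σ : F →ₐ[ℚ] F) (v : F) : galPerm F g σ v = g (σ v) := rfl

omit [DecidableEq F] [DecidableEq (F →ₐ[ℚ] F)] in
/-- `g(χ_k(x)) = χ_{k'}(x)` with `k' = k ∘ (g ∘ ·)⁻¹` (Lemma A2.2(ii), first step). -/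
theorem map_chi (n : ℕ) (x : F) (g : Gal(F/ℚ)) (k : (F →ₐ[ℚ] F) → Fin (n + 1)) :
    g (chi F n x k) = chi F n x (k ∘ (galPerm F g).symm) := by
  unfold chi
  rw [map_prod]
  simp only [map_pow]
  exact Fintype.prod_equiv (galPerm F g) _ _ fun σ => by
    simp only [Function.comp_apply, Equiv.symm_apply_apply, galPerm_apply]

omit [FiniteDimensional ℚ F] [DecidableEq F] in
/-- The permutation `σ ↦ g ∘ σ` carries Weil indices to Weil indices. -/
theorem weilIdx_comp (n : ℕ) (g : Gal(F/ℚ)) (σ : F →ₐ[ℚ] F) :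
    weilIdx F n σ ∘ (galPerm F g).symm = weilIdx F n (galPerm F g σ) := by
  funext τ
  simp only [weilIdx, Function.comp_apply, Pi.single_apply, Equiv.symm_apply_eq]

/-- `Λ` is stable under `Gal(F/ℚ)` (Lemma A2.2(ii)). -/
theorem nodes_galStable (n : ℕ) (x : F) (g : Gal(F/ℚ)) {a : F} (ha : a ∈ nodes F n x) :
    g a ∈ nodes F n x := by
  obtain ⟨k, rfl⟩ := (mem_nodes F).1 ha
  rw [map_chi]
  exact (mem_nodes F).2 ⟨_, rfl⟩

/-- `Λ_W` is stable under `Gal(F/ℚ)` (Lemma A2.2(ii)). -/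
theorem weilNodes_galStable (n : ℕ) (x : F) (g : Gal(F/ℚ)) {a : F} (ha : a ∈ weilNodes F n x) :
    g a ∈ weilNodes F n x := by
  obtain ⟨σ, rfl⟩ := (mem_weilNodes F).1 ha
  rw [map_chi, weilIdx_comp]
  exact (mem_weilNodes F).2 ⟨_, rfl⟩

/-- Lemma A2.2(ii): the Lagrange projector polynomial is rational (p7's `A1Lagrange`). -/
theorem exists_rat_lagrangeP [IsGalois ℚ F] (n : ℕ) (x : F) :
    ∃ Q : ℚ[X], Q.map (algebraMap ℚ F) = lagrangeP F n x :=
  A1Lagrange.exists_rat_poly_map_eq _ _ (fun g _ ha => nodes_galStable F n x g ha)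
    (fun g _ ha => weilNodes_galStable F n x g ha)

end Summit.Ventures.HodgeRepro2.T6.A1WeilProjector
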